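import Literature.Analysis.FunctionSpaces.TorusConvolution
import Literature.Analysis.FunctionSpaces.BesovDifference
import HarnessLib

/-!
# Mollification on `T^d` against translation moduli: the Constantin–E–Titi estimates

Analysis/FunctionSpaces support file (serves the discharge of Onsager rigidity,
`Literature.Analysis.FluidPDE.onsager_rigidity`, `FluidPDE/Onsager`; Constantin–E–Titi 1994, facts (6)–(8) of the
proof). For the standard mollifier `k_ε = Torus.kernel ε` on the flat torus (`TorusMollifier`,
`TorusConvolution`; mollification `θ ⋆ k_ε` in the tree's convention, rough factor on the left)
and a function `θ` whose `Lᵖ` translation modulus at scale `ε` is at most `A`,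
`‖θ(· - y) - θ‖_{Lᵖ} ≤ A` for `‖y‖ ≤ ε`, we prove

* `Torus.kernel_neg`: the kernel is even, and its partial derivatives are odd;
* `Literature.Analysis.FunctionSpaces.eLpNorm_integral_smul_le_mul` — **Minkowski–Jensen for kernel averages**: on any pair of
  s-finite measure spaces, `‖x ↦ ∫ k(y) • Φ(x, y) dy‖_{Lᵖ} ≤ ‖k‖_{L¹} · A` whenever
  `‖Φ(·, y)‖_{Lᵖ} ≤ A` wherever `k(y) ≠ 0` (`1 ≤ p < ∞`; Hölder in `y` against the probability
  `|k|/‖k‖₁`, then Tonelli);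
* `Torus.eLpNorm_convolution_kernel_sub_self_le` — CET (6): `‖θ ⋆ k_ε - θ‖_{Lᵖ} ≤ A`;
* `Torus.eLpNorm_partialDeriv_convolution_kernel_le` — CET (7):
  `‖∂ⱼ(θ ⋆ k_ε)‖_{Lᵖ} ≤ (C₁/ε) A` with `C₁ = Torus.gradProfileMass`;
* the Besov glue `Torus.eLpNorm_comp_sub_sub_le_eBesovSupSeminorm`: for `θ ∈ B^s_{p,∞}(T^d)` the
  modulus is `A = [θ]_{B^s_{p,∞}} ε^s`, which turns (6)–(7) into the printed
  `‖θ ⋆ k_ε - θ‖_{Lᵖ} ≤ C ε^s ‖θ‖_{B^s_{p,∞}}`, `‖∇(θ ⋆ k_ε)‖_{Lᵖ} ≤ C ε^{s-1} ‖θ‖_{B^s_{p,∞}}`.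

## Mathlib search

Mathlib (this pin) has Young's inequality only through the tree
(`Literature.Analysis.UnboundedOperators.eLpNorm_convolution_le_lintegral_enorm_mul`, `UnboundedOperators/HeatKernel`) and no
Minkowski integral inequality for `eLpNorm` (searched `Minkowski`, `eLpNorm_integral`,
`lintegral_lintegral` + `rpow` in `MeasureTheory/Integral/MeanInequalities`,
`MeasureTheory/Function/LpSeminorm`); the Jensen step is the tree's
`Literature.Analysis.UnboundedOperators.lintegral_mul_rpow_le_of_one_le`.

## References

* P. Constantin, W. E, E. S. Titi, *Onsager's conjecture on the energy conservation for solutions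
  of Euler's equation*, Comm. Math. Phys. 165 (1994), 207–209, (6)–(8).
* L. C. Evans, *Partial Differential Equations*, 2nd ed. (AMS 2010), App. C.4, Thm. 7.
-/

noncomputable section

open MeasureTheory TopologicalSpace Set Function Filter Topology Metric ContinuousLinearMap
open scoped ENNReal NNReal Convolution InnerProductSpace

namespace Literature.Analysis.FunctionSpaces

/-! ## Minkowski–Jensen for kernel averages -/

section MinkowskiJensen

variable {X Y : Type*} [MeasurableSpace X] [MeasurableSpace Y] {μ : Measure X} {ν : Measure Y}
  [SFinite μ] [SFinite ν]
variable {F : Type*} [NormedAddCommGroup F] [NormedSpace ℝ F]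

/-- **Minkowski–Jensen for kernel averages**, `lintegral` form: for a real weight `k` on `Y`,
a jointly measurable `Φ : X × Y → F` and `1 ≤ p`, if `∫ ‖Φ(·, y)‖^p ≤ B` wherever `k y ≠ 0`,
then `∫ ‖∫ k(y) • Φ(x, y) dy‖^p dx ≤ (∫ |k|)^p B` (Hölder in `y` with the weight `|k|`,
the tree's `Literature.Analysis.UnboundedOperators.lintegral_mul_rpow_le_of_one_le`, then Tonelli). [folklore] -/
theorem lintegral_rpow_enorm_integral_smul_le {k : Y → ℝ} (hk : AEStronglyMeasurable k ν)
    {Φ : X → Y → F} (hΦ : AEStronglyMeasurable (uncurry Φ) (μ.prod ν)) {p : ℝ} (hp : 1 ≤ p)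
    {B : ℝ≥0∞} (hB : ∀ᵐ y ∂ν, k y ≠ 0 → ∫⁻ x, ‖Φ x y‖ₑ ^ p ∂μ ≤ B) :
    ∫⁻ x, ‖∫ y, k y • Φ x y ∂ν‖ₑ ^ p ∂μ ≤ (∫⁻ y, ‖k y‖ₑ ∂ν) ^ p * B := by
  have hp0 : 0 < p := one_pos.trans_le hp
  set K : ℝ≥0∞ := ∫⁻ y, ‖k y‖ₑ ∂ν with hK
  have hkm : AEMeasurable (fun y => ‖k y‖ₑ) ν := hk.enorm
  have hΦm : AEMeasurable (fun z : X × Y => ‖Φ z.1 z.2‖ₑ ^ p) (μ.prod ν) := hΦ.enorm.pow_const _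
  have hG : AEMeasurable (fun z : X × Y => ‖k z.2‖ₑ * ‖Φ z.1 z.2‖ₑ ^ p) (μ.prod ν) :=
    hkm.comp_snd.mul hΦm
  -- sections
  have hsecx : ∀ᵐ x ∂μ, AEStronglyMeasurable (fun y => Φ x y) ν := hΦ.prodMk_left
  have hsecy : ∀ᵐ y ∂ν, AEStronglyMeasurable (fun x => Φ x y) μ :=
    (hΦ.prod_swap : AEStronglyMeasurable (fun z : Y × X => Φ z.2 z.1) (ν.prod μ)).prodMk_left
  -- pointwise: `‖∫ k Φ‖^p ≤ (∫ |k| ‖Φ‖)^p ≤ K^{p-1} ∫ |k| ‖Φ‖^p`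
  have hpt : ∀ᵐ x ∂μ, ‖∫ y, k y • Φ x y ∂ν‖ₑ ^ p ≤
      K ^ (p - 1) * ∫⁻ y, ‖k y‖ₑ * ‖Φ x y‖ₑ ^ p ∂ν := by
    filter_upwards [hsecx] with x hx
    calc ‖∫ y, k y • Φ x y ∂ν‖ₑ ^ p ≤ (∫⁻ y, ‖k y‖ₑ * ‖Φ x y‖ₑ ∂ν) ^ p := by
          refine ENNReal.rpow_le_rpow ((enorm_integral_le_lintegral_enorm _).trans_eq ?_) hp0.le
          simp_rw [enorm_smul]
      _ ≤ K ^ (p - 1) * ∫⁻ y, ‖k y‖ₑ * ‖Φ x y‖ₑ ^ p ∂ν :=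
          UnboundedOperators.lintegral_mul_rpow_le_of_one_le hkm hx.enorm hp
  calc ∫⁻ x, ‖∫ y, k y • Φ x y ∂ν‖ₑ ^ p ∂μ
      ≤ ∫⁻ x, K ^ (p - 1) * ∫⁻ y, ‖k y‖ₑ * ‖Φ x y‖ₑ ^ p ∂ν ∂μ := lintegral_mono_ae hpt
    _ = K ^ (p - 1) * ∫⁻ y, ∫⁻ x, ‖k y‖ₑ * ‖Φ x y‖ₑ ^ p ∂μ ∂ν := by
        rw [lintegral_const_mul'' _ hG.lintegral_prod_right']
        exact congrArg _ (lintegral_lintegral_swap hG)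
    _ = K ^ (p - 1) * ∫⁻ y, ‖k y‖ₑ * ∫⁻ x, ‖Φ x y‖ₑ ^ p ∂μ ∂ν := by
        congr 1
        refine lintegral_congr_ae ?_
        filter_upwards [hsecy] with y hy
        rw [lintegral_const_mul'' _ (hy.enorm.pow_const _)]
    _ ≤ K ^ (p - 1) * ∫⁻ y, ‖k y‖ₑ * B ∂ν := by
        gcongr K ^ (p - 1) * ?_
        refine lintegral_mono_ae ?_
        filter_upwards [hB] with y hy
        by_cases hky : k y = 0
        · simp [hky]
        · exact mul_le_mul_right (hy hky) _
    _ = K ^ p * B := by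
        rw [lintegral_mul_const'' _ hkm, ← mul_assoc, ← hK]
        congr 1
        conv_rhs => rw [← sub_add_cancel p 1, ENNReal.rpow_add_of_nonneg _ _ (by linarith)
          zero_le_one, ENNReal.rpow_one]

/-- **Minkowski–Jensen for kernel averages**, `eLpNorm` form (`1 ≤ p < ∞`): if
`‖Φ(·, y)‖_{Lᵖ(μ)} ≤ A` wherever `k y ≠ 0`, then
`‖x ↦ ∫ k(y) • Φ(x, y) dν(y)‖_{Lᵖ(μ)} ≤ ‖k‖_{L¹(ν)} · A`. [folklore] -/
theorem eLpNorm_integral_smul_le_mul {k : Y → ℝ} (hk : AEStronglyMeasurable k ν)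
    {Φ : X → Y → F} (hΦ : AEStronglyMeasurable (uncurry Φ) (μ.prod ν)) {p : ℝ≥0∞} (hp : 1 ≤ p)
    (hp' : p ≠ ⊤) {A : ℝ≥0∞} (hA : ∀ᵐ y ∂ν, k y ≠ 0 → eLpNorm (fun x => Φ x y) p μ ≤ A) :
    eLpNorm (fun x => ∫ y, k y • Φ x y ∂ν) p μ ≤ (∫⁻ y, ‖k y‖ₑ ∂ν) * A := by
  have hp0 : p ≠ 0 := (zero_lt_one.trans_le hp).ne'
  have hpr : 1 ≤ p.toReal := by
    simpa using (ENNReal.toReal_le_toReal ENNReal.one_ne_top hp').2 hp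
  have hpr0 : 0 < p.toReal := one_pos.trans_le hpr
  rw [eLpNorm_eq_lintegral_rpow_enorm_toReal hp0 hp']
  have hB : ∀ᵐ y ∂ν, k y ≠ 0 → ∫⁻ x, ‖Φ x y‖ₑ ^ p.toReal ∂μ ≤ A ^ p.toReal := by
    filter_upwards [hA] with y hy hky
    have h := hy hky
    rw [eLpNorm_eq_lintegral_rpow_enorm_toReal hp0 hp'] at h
    have h' := ENNReal.rpow_le_rpow h hpr0.le
    rwa [← ENNReal.rpow_mul, one_div_mul_cancel hpr0.ne', ENNReal.rpow_one] at h'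
  calc (∫⁻ x, ‖∫ y, k y • Φ x y ∂ν‖ₑ ^ p.toReal ∂μ) ^ (1 / p.toReal)
      ≤ ((∫⁻ y, ‖k y‖ₑ ∂ν) ^ p.toReal * A ^ p.toReal) ^ (1 / p.toReal) :=
        ENNReal.rpow_le_rpow (lintegral_rpow_enorm_integral_smul_le hk hΦ hpr hB) (by positivity)
    _ = (∫⁻ y, ‖k y‖ₑ ∂ν) * A := by
        rw [ENNReal.mul_rpow_of_nonneg _ _ (by positivity), ← ENNReal.rpow_mul, ← ENNReal.rpow_mul,
          mul_one_div_cancel hpr0.ne', ENNReal.rpow_one, ENNReal.rpow_one]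

end MinkowskiJensen

/-! ## The torus kernel: evenness, and the CET estimates -/

namespace Torus

open scoped RealInnerProductSpace

variable {d : Type*} [Fintype d] {ε : ℝ}

/-- The rescaled profile is even: `ρ_ε(-v) = ρ_ε(v)` (the bump is radial). [folklore] -/
theorem profile_neg (ε : ℝ) (v : EuclideanSpace ℝ d) : profile ε (-v) = profile ε v := by
  simp only [profile, smul_neg, profileOne, ContDiffBump.normed_neg]

/-- **The torus kernel is even**: `kernel ε (-z) = kernel ε z` (`0 < ε ≤ 1/4`; the profile is
even and supported in `B(0, 1/4)`, where `reprc (-z) = -reprc z`). [folklore] -/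
theorem kernel_neg (hε : 0 < ε) (hε' : ε ≤ 1 / 4) (z : UnitAddTorus d) :
    kernel ε (-z) = kernel ε z := by
  have key : ∀ w : UnitAddTorus d, ‖reprc w‖ < 1 / 2 → kernel ε (-w) = kernel ε w := by
    intro w hw
    have h1 : -w = proj (-reprc w) := by rw [proj_neg, proj_reprc]
    rw [kernel, transplant_apply, transplant_apply, h1, reprc_proj_of_norm_lt (by rwa [norm_neg]),
      profile_neg]
  by_cases hz : ‖reprc z‖ < 1 / 2
  · exact key z hz
  by_cases hz' : ‖reprc (-z)‖ < 1 / 2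
  · have h := key (-z) hz'
    rw [neg_neg] at h
    exact h.symm
  · have hvan : ∀ w : UnitAddTorus d, ¬‖reprc w‖ < 1 / 2 → kernel ε w = 0 := fun w hw => by
      rw [kernel, transplant_apply]
      by_contra h
      have := support_profile_subset hε h
      rw [mem_ball_zero_iff] at this
      exact hw (by linarith)
    rw [hvan z hz, hvan (-z) hz']

/-- `kernel ε (x - y) = kernel ε (y - x)`. [folklore] -/
theorem kernel_sub_comm (hε : 0 < ε) (hε' : ε ≤ 1 / 4) (x y : UnitAddTorus d) :
    kernel ε (x - y) = kernel ε (y - x) := by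
  rw [← neg_sub, kernel_neg hε hε']

variable [DecidableEq d] in
/-- The partial derivatives of the (even) torus kernel are odd:
`∂ⱼ kernel ε (-z) = -∂ⱼ kernel ε z`. [folklore] -/
theorem partialDeriv_kernel_neg (hε : 0 < ε) (hε' : ε ≤ 1 / 4) (j : d) (z : UnitAddTorus d) :
    partialDeriv j (kernel ε) (-z) = -partialDeriv j (kernel ε) z := by
  have hk1 : IsContDiff 1 (kernel (d := d) ε) := (isSmooth_kernel hε hε').isContDiff (by simp)
  have h := partialDeriv_comp_sub_left hk1 j 0 z
  have hfun : (fun y : UnitAddTorus d => kernel ε (0 - y)) = kernel ε := by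
    funext y
    rw [zero_sub, kernel_neg hε hε']
  rw [hfun, zero_sub] at h
  rw [h, neg_neg]

variable [DecidableEq d] in
/-- `∂ⱼ kernel ε (x - y) = -∂ⱼ kernel ε (y - x)`. [folklore] -/
theorem partialDeriv_kernel_sub_comm (hε : 0 < ε) (hε' : ε ≤ 1 / 4) (j : d) (x y : UnitAddTorus d) :
    partialDeriv j (kernel ε) (x - y) = -partialDeriv j (kernel ε) (y - x) := by
  rw [← neg_sub, partialDeriv_kernel_neg hε hε']

/-! ## Coordinates of the gradient -/

variable [DecidableEq d] in
/-- The `j`-th coordinate of the torus gradient is the `j`-th partial derivative (`C¹` functions). [folklore] -/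
theorem gradient_apply {θ : UnitAddTorus d → ℝ} (hθ : IsContDiff 1 θ) (x : UnitAddTorus d) (j : d) :
    Torus.gradient θ x j = partialDeriv j θ x := by
  rw [gradient_eq_sum_partialDeriv hθ]
  simp [Finset.sum_apply, Pi.single_apply]

variable [DecidableEq d] in
/-- `|∂ⱼ θ(x)| ≤ ‖∇θ(x)‖` for `C¹` scalar `θ`. [folklore] -/
theorem abs_partialDeriv_le_norm_gradient {θ : UnitAddTorus d → ℝ} (hθ : IsContDiff 1 θ)
    (x : UnitAddTorus d) (j : d) : |partialDeriv j θ x| ≤ ‖Torus.gradient θ x‖ := by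
  rw [← gradient_apply hθ]
  simpa using PiLp.norm_apply_le (Torus.gradient θ x) j

variable [DecidableEq d] in
/-- `∫⁻ ‖∂ⱼ kernel ε‖ₑ ≤ ENNReal.ofReal (C₁ / ε)` (`0 < ε ≤ 1/4`). [folklore] -/
theorem lintegral_enorm_partialDeriv_kernel_le (hε : 0 < ε) (hε' : ε ≤ 1 / 4) (j : d) :
    ∫⁻ z, ‖partialDeriv j (kernel (d := d) ε) z‖ₑ ≤ ENNReal.ofReal (ε⁻¹ * gradProfileMass d) := by
  rw [← lintegral_enorm_gradient_kernel hε hε']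
  refine lintegral_mono fun z => ?_
  rw [Real.enorm_eq_ofReal_abs, ← ofReal_norm]
  exact ENNReal.ofReal_le_ofReal
    (abs_partialDeriv_le_norm_gradient ((isSmooth_kernel hε hε').isContDiff (by simp)) z j)

/-! ## CET (6): mollification error against the translation modulus -/

/-- The convolution integrand read with the kernel variable first is integrable:
`y ↦ k y • θ (x - y)`. [folklore] -/
theorem integrable_kernel_smul_comp_sub {F' : Type*} [NormedAddCommGroup F'] [NormedSpace ℝ F']
    {θ : UnitAddTorus d → F'} (hθ : Integrable θ volume) {k : UnitAddTorus d → ℝ} (hk : Continuous k)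
    (x : UnitAddTorus d) : Integrable (fun y => k y • θ (x - y)) volume := by
  have h : Integrable (fun y => k (x - y) • θ y) volume := by
    obtain ⟨C, hC⟩ := exists_forall_norm_le_of_continuous hk
    exact hθ.bdd_smul C (hk.comp (continuous_const.sub continuous_id)).aestronglyMeasurable
      (Eventually.of_forall fun y => hC _)
  have h2 := h.comp_sub_left x
  simp only [sub_sub_cancel] at h2
  exact h2

/-- The mollification error as a kernel average of differences:
`(θ ⋆ k_ε)(x) - θ(x) = ∫ k_ε(y) (θ(x - y) - θ(x)) dy`. [folklore] -/
theorem convolution_kernel_sub_self_apply {θ : UnitAddTorus d → ℝ} (hθ : Integrable θ volume)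
    (hε : 0 < ε) (hε' : ε ≤ 1 / 4) (x : UnitAddTorus d) :
    (θ ⋆ kernel ε) x - θ x = ∫ y, kernel ε y • (θ (x - y) - θ x) := by
  have hk := continuous_kernel (d := d) hε hε'
  rw [convolution_comm_real, convolution_lsmul]
  simp only [smul_eq_mul, mul_sub]
  have hi : Integrable (fun y => kernel ε y * θ (x - y)) volume :=
    integrable_kernel_smul_comp_sub hθ hk x
  rw [integral_sub hi ((hk.integrable_unitAddTorus).mul_const _), integral_mul_const,
    integral_kernel hε hε', one_mul]

omit [Fintype d] in
/-- Joint measurability of `(x, y) ↦ θ (x - y) - θ x`. [folklore] -/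
theorem aestronglyMeasurable_comp_sub_sub [Fintype d] {F' : Type*} [NormedAddCommGroup F']
    {θ : UnitAddTorus d → F'} (hθ : AEStronglyMeasurable θ volume) :
    AEStronglyMeasurable (uncurry fun x y : UnitAddTorus d => θ (x - y) - θ x)
      ((volume : Measure (UnitAddTorus d)).prod volume) := by
  refine AEStronglyMeasurable.sub ?_ ?_
  · exact hθ.comp_quasiMeasurePreserving (quasiMeasurePreserving_sub_of_right_invariant volume volume)
  · exact hθ.comp_fst

/-- **CET (6).** If `‖θ(· - y) - θ‖_{Lᵖ} ≤ A` for all `‖y‖ ≤ ε`, then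
`‖θ ⋆ k_ε - θ‖_{Lᵖ} ≤ A` (`1 ≤ p < ∞`, `0 < ε ≤ 1/4`; Constantin–E–Titi 1994, (6), with the
Besov bound replaced by the translation modulus it comes from). [cite: ConstantinETiti1994, (6)] -/
theorem eLpNorm_convolution_kernel_sub_self_le {θ : UnitAddTorus d → ℝ} (hθ : Integrable θ volume)
    (hε : 0 < ε) (hε' : ε ≤ 1 / 4) {p : ℝ≥0∞} (hp : 1 ≤ p) (hp' : p ≠ ⊤) {A : ℝ≥0∞}
    (hA : ∀ y : UnitAddTorus d, ‖y‖ ≤ ε → eLpNorm (fun x => θ (x - y) - θ x) p volume ≤ A) :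
    eLpNorm (θ ⋆ kernel ε - θ) p volume ≤ A := by
  have hfun : (θ ⋆ kernel ε - θ) = fun x => ∫ y, kernel ε y • (θ (x - y) - θ x) :=
    funext fun x => convolution_kernel_sub_self_apply hθ hε hε' x
  rw [hfun]
  refine (eLpNorm_integral_smul_le_mul (continuous_kernel hε hε').aestronglyMeasurable
    (aestronglyMeasurable_comp_sub_sub hθ.aestronglyMeasurable) hp hp'
    (Eventually.of_forall fun y hy => hA y ?_)).trans ?_
  · exact (mem_ball_zero_iff.1 (support_kernel_subset hε hy)).le
  · rw [lintegral_enorm_kernel hε hε', one_mul]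

/-! ## CET (7): derivatives of mollifications against the translation modulus -/

variable [DecidableEq d] in
/-- The partial derivative of a mollification as a kernel average of differences:
`∂ⱼ(θ ⋆ k_ε)(x) = ∫ ∂ⱼk_ε(y) (θ(x - y) - θ(x)) dy` (`∫ ∂ⱼ k_ε = 0`). [folklore] -/
theorem partialDeriv_convolution_kernel_apply {θ : UnitAddTorus d → ℝ} (hθ : Integrable θ volume)
    (hε : 0 < ε) (hε' : ε ≤ 1 / 4) (j : d) (x : UnitAddTorus d) :
    partialDeriv j (θ ⋆ kernel ε) x =
      ∫ y, partialDeriv j (kernel ε) y • (θ (x - y) - θ x) := by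
  have hk := isSmooth_kernel (d := d) hε hε'
  have hkj : Continuous (partialDeriv j (kernel (d := d) ε)) := (hk.partialDeriv j).continuous
  rw [partialDeriv_convolution hθ hk, convolution_comm_real, convolution_lsmul]
  simp only [smul_eq_mul, mul_sub]
  have hi : Integrable (fun y => partialDeriv j (kernel ε) y * θ (x - y)) volume :=
    integrable_kernel_smul_comp_sub hθ hkj x
  rw [integral_sub hi ((hkj.integrable_unitAddTorus).mul_const _),
    integral_mul_const, integral_partialDeriv_eq_zero_holds hk j, zero_mul, sub_zero]

variable [DecidableEq d] in
/-- **CET (7).** If `‖θ(· - y) - θ‖_{Lᵖ} ≤ A` for all `‖y‖ ≤ ε`, then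
`‖∂ⱼ(θ ⋆ k_ε)‖_{Lᵖ} ≤ (C₁/ε) A` (`1 ≤ p < ∞`, `0 < ε ≤ 1/4`, `C₁ = ∫ ‖Dρ₁‖`; Constantin–E–Titi
1994, (7), with the Besov bound replaced by the translation modulus). [cite: ConstantinETiti1994, (7)] -/
theorem eLpNorm_partialDeriv_convolution_kernel_le {θ : UnitAddTorus d → ℝ} (hθ : Integrable θ volume)
    (hε : 0 < ε) (hε' : ε ≤ 1 / 4) {p : ℝ≥0∞} (hp : 1 ≤ p) (hp' : p ≠ ⊤) {A : ℝ≥0∞}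
    (hA : ∀ y : UnitAddTorus d, ‖y‖ ≤ ε → eLpNorm (fun x => θ (x - y) - θ x) p volume ≤ A) (j : d) :
    eLpNorm (partialDeriv j (θ ⋆ kernel ε)) p volume ≤ ENNReal.ofReal (ε⁻¹ * gradProfileMass d) * A := by
  have hk := isSmooth_kernel (d := d) hε hε'
  have hk1 : IsContDiff 1 (kernel (d := d) ε) := hk.isContDiff (by simp)
  have hkj : Continuous (partialDeriv j (kernel (d := d) ε)) := (hk.partialDeriv j).continuous
  have hfun : partialDeriv j (θ ⋆ kernel ε) =
      fun x => ∫ y, partialDeriv j (kernel ε) y • (θ (x - y) - θ x) :=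
    funext fun x => partialDeriv_convolution_kernel_apply hθ hε hε' j x
  rw [hfun]
  refine (eLpNorm_integral_smul_le_mul hkj.aestronglyMeasurable
    (aestronglyMeasurable_comp_sub_sub hθ.aestronglyMeasurable) hp hp'
    (Eventually.of_forall fun y hy => hA y ?_)).trans ?_
  · refine norm_le_of_gradient_kernel_ne_zero hε hε' fun h => hy ?_
    have := abs_partialDeriv_le_norm_gradient hk1 y j
    rw [h, norm_zero] at this
    exact abs_eq_zero.1 (le_antisymm this (abs_nonneg _))
  · exact mul_le_mul_left (lintegral_enorm_partialDeriv_kernel_le hε hε' j) _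

/-! ## The Besov modulus -/

/-- For `θ ∈ B^s_{p,∞}(T^d)`, `0 < s`, the translation modulus at scale `ε` is
`[θ]_{B^s_{p,∞}} ε^s`: `‖θ(· - y) - θ‖_{Lᵖ} ≤ [θ]_{B^s_{p,∞}} ε^s` for `‖y‖ ≤ ε`
(Constantin–E–Titi 1994, (6)). [cite: ConstantinETiti1994, (6)] -/
theorem eLpNorm_comp_sub_sub_le_eBesovSupSeminorm {F' : Type*} [NormedAddCommGroup F']
    {θ : UnitAddTorus d → F'} {s : ℝ} (hs : 0 < s) {p : ℝ≥0∞} {y : UnitAddTorus d}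
    (hy : ‖y‖ ≤ ε) :
    eLpNorm (fun x => θ (x - y) - θ x) p volume ≤
      eBesovSupSeminorm s p θ volume * ENNReal.ofReal (ε ^ s) := by
  by_cases hy0 : y = 0
  · subst hy0
    simp
  calc eLpNorm (fun x => θ (x - y) - θ x) p volume
      = eLpNorm (fun x => θ (x + -y) - θ x) p volume := by simp_rw [sub_eq_add_neg]
    _ ≤ eBesovSupSeminorm s p θ volume * ENNReal.ofReal (‖-y‖ ^ s) :=
        eLpNorm_sub_le_eBesovSupSeminorm_mul (neg_ne_zero.2 hy0)
    _ ≤ eBesovSupSeminorm s p θ volume * ENNReal.ofReal (ε ^ s) := by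
        gcongr
        rw [norm_neg]
        exact hy

/-- Coordinates are `1`-Lipschitz: the translation modulus of a coordinate of a vector field is
at most that of the field. [folklore] -/
theorem eLpNorm_apply_comp_sub_sub_le {ι : Type*} [Fintype ι] {θ : UnitAddTorus d → EuclideanSpace ℝ ι}
    (i : ι) (y : UnitAddTorus d) (p : ℝ≥0∞) :
    eLpNorm (fun x => θ (x - y) i - θ x i) p volume ≤ eLpNorm (fun x => θ (x - y) - θ x) p volume := by
  refine eLpNorm_mono fun x => ?_
  rw [Real.norm_eq_abs]
  simpa using PiLp.norm_apply_le (θ (x - y) - θ x) i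

end Torus

end Literature.Analysis.FunctionSpaces
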